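import Literature.LinearAlgebra.Matrix.GeneralLinearGroupSquares
import Mathlib.Algebra.Group.Subgroup.Finite
import Mathlib.Algebra.Group.Pi.Units
import HarnessLib

/-!
# `GL_n` over finite products of rings: generation by squares is inherited

Layer `Literature/LinearAlgebra/Matrix`, namespace `Literature.LinearAlgebra.Matrix.GeneralLinearGroup` (sequel of
`GeneralLinearGroupSquares`).  THEOREMS ONLY.

The property "`GL_ι(R)` is generated by its squares" (`Subgroup.closure {g | IsSquare g} = ⊤`; for `R` a square-closed
field with `2 ≠ 0` this is `GeneralLinearGroup.closure_isSquare_eq_top`, a corollary of the generation of `GL_n` by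
transvections and diagonal matrices [Artin1988, Chap. IV Thm. 4.6]) passes

* along ring isomorphisms (`closure_isSquare_eq_top_of_ringEquiv`),
* to binary products of rings (`closure_isSquare_eq_top_prod`: `GL_ι(A × B) ≅ GL_ι(A) × GL_ι(B)`), and
* to finite products of rings (`closure_isSquare_eq_top_pi`: `GL_ι(∏ₖ Rₖ) ≅ ∏ₖ GL_ι(Rₖ)`; vacuous — hence true — over an
  empty index set, where the ring is trivial),

so that e.g. `GL_ι(K ⊗_ℚ ℝ) = GL_ι(ℝ^{r₁} × ℂ^{r₂})` is generated by squares for a totally complex number field `K`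
(`r₁ = 0`; consumer: `NumberTheory/Automorphic/UnitaryGroupArchSiegelSquares`).  The matrix-ring isomorphisms
`M_ι(∏ₖ Rₖ) ≅ ∏ₖ M_ι(Rₖ)`, `M_ι(A × B) ≅ M_ι(A) × M_ι(B)` are built inside the proofs (entrywise evaluation); no definition
is introduced.

## References

* [Artin1988] E. Artin, *Geometric Algebra*, Chap. IV Thm. 4.6 (generation of `GL_n`), of which these are transport
  corollaries.
-/

set_option autoImplicit false

open Matrix

namespace Literature.LinearAlgebra.Matrix.GeneralLinearGroup

variable {ι : Type*} [Fintype ι] [DecidableEq ι]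

/-- The image of the subgroup generated by squares lies in the subgroup generated by squares. [folklore] -/
private theorem map_closure_isSquare_le' {G G' : Type*} [Group G] [Group G'] (f : G →* G') :
    (Subgroup.closure {g : G | IsSquare g}).map f ≤ Subgroup.closure {g : G' | IsSquare g} := by
  rw [Subgroup.map_le_iff_le_comap, Subgroup.closure_le]
  intro g hg
  obtain ⟨r, rfl⟩ := hg
  change f (r * r) ∈ Subgroup.closure {g : G' | IsSquare g}
  rw [map_mul]
  exact Subgroup.subset_closure ⟨f r, rfl⟩

/-- Generation by squares passes along a surjective homomorphism. [folklore] -/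
private theorem closure_isSquare_eq_top_of_surjective' {G G' : Type*} [Group G] [Group G']
    (hG : Subgroup.closure {g : G | IsSquare g} = ⊤) (f : G →* G') (hf : Function.Surjective f) :
    Subgroup.closure {g : G' | IsSquare g} = ⊤ := by
  rw [eq_top_iff]
  intro y _
  obtain ⟨x, rfl⟩ := hf y
  exact map_closure_isSquare_le' f (Subgroup.mem_map_of_mem f (hG ▸ Subgroup.mem_top x))

/-- **Transport along a ring isomorphism**: if `GL_ι(R)` is generated by squares and `R ≃+* R'`, so is `GL_ι(R')`.
[cite: Artin1988, Chap. IV Thm. 4.6] -/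
theorem closure_isSquare_eq_top_of_ringEquiv {R R' : Type*} [CommRing R] [CommRing R'] (f : R ≃+* R')
    (hR : Subgroup.closure {g : GL ι R | IsSquare g} = ⊤) :
    Subgroup.closure {g : GL ι R' | IsSquare g} = ⊤ :=
  let Ψ : GL ι R ≃* GL ι R' := Units.mapEquiv (f.mapMatrix : Matrix ι ι R ≃+* Matrix ι ι R').toMulEquiv
  closure_isSquare_eq_top_of_surjective' hR Ψ.toMonoidHom Ψ.surjective

/-- **Binary products**: if `GL_ι(A)` and `GL_ι(B)` are generated by squares, so is `GL_ι(A × B)`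
(`M_ι(A × B) ≅ M_ι(A) × M_ι(B)` entrywise, `(M × N)ˣ ≅ Mˣ × Nˣ`). [cite: Artin1988, Chap. IV Thm. 4.6] -/
theorem closure_isSquare_eq_top_prod {A B : Type*} [CommRing A] [CommRing B]
    (hA : Subgroup.closure {g : GL ι A | IsSquare g} = ⊤) (hB : Subgroup.closure {g : GL ι B | IsSquare g} = ⊤) :
    Subgroup.closure {g : GL ι (A × B) | IsSquare g} = ⊤ := by
  -- the matrix ring over a product is the product of the matrix rings
  let φ : Matrix ι ι (A × B) ≃+* Matrix ι ι A × Matrix ι ι B :=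
    { toFun := fun M => (M.map Prod.fst, M.map Prod.snd)
      invFun := fun P => Matrix.of fun i j => (P.1 i j, P.2 i j)
      left_inv := fun M => by ext i j <;> rfl
      right_inv := fun P => by ext i j <;> rfl
      map_mul' := fun M N => by
        ext i j
        · change ((M * N).map (RingHom.fst A B)) i j = _
          rw [Matrix.map_mul]; rfl
        · change ((M * N).map (RingHom.snd A B)) i j = _
          rw [Matrix.map_mul]; rfl
      map_add' := fun M N => by ext i j <;> rfl }
  -- units of a product
  let Φ : GL ι (A × B) ≃* GL ι A × GL ι B := (Units.mapEquiv φ.toMulEquiv).trans MulEquiv.prodUnits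
  refine closure_isSquare_eq_top_of_surjective' ?_ Φ.symm.toMonoidHom Φ.symm.surjective
  -- squares generate `GL_ι(A) × GL_ι(B)`
  rw [eq_top_iff]
  rintro ⟨a, b⟩ -
  have ha : (a, (1 : GL ι B)) ∈ Subgroup.closure {g : GL ι A × GL ι B | IsSquare g} :=
    map_closure_isSquare_le' (MonoidHom.inl (GL ι A) (GL ι B)) (Subgroup.mem_map_of_mem _ (hA ▸ Subgroup.mem_top a))
  have hb : ((1 : GL ι A), b) ∈ Subgroup.closure {g : GL ι A × GL ι B | IsSquare g} :=
    map_closure_isSquare_le' (MonoidHom.inr (GL ι A) (GL ι B)) (Subgroup.mem_map_of_mem _ (hB ▸ Subgroup.mem_top b))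
  have := Subgroup.mul_mem _ ha hb
  simpa using this

/-- **Finite products**: if every `GL_ι(R k)` is generated by squares (`k` ranging over a finite index type, possibly
empty), so is `GL_ι(∏ₖ R k)` (`M_ι(∏ R k) ≅ ∏ M_ι(R k)` entrywise, `(∏ M k)ˣ ≅ ∏ (M k)ˣ`, and an element of a finite
product of groups is the product of its one-coordinate components). [cite: Artin1988, Chap. IV Thm. 4.6] -/
theorem closure_isSquare_eq_top_pi {κ : Type*} [Fintype κ] [DecidableEq κ] (R : κ → Type*) [∀ k, CommRing (R k)]
    (hR : ∀ k, Subgroup.closure {g : GL ι (R k) | IsSquare g} = ⊤) :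
    Subgroup.closure {g : GL ι (∀ k, R k) | IsSquare g} = ⊤ := by
  -- the matrix ring over a product is the product of the matrix rings
  let φ : Matrix ι ι (∀ k, R k) ≃+* ∀ k, Matrix ι ι (R k) :=
    { toFun := fun M k => M.map (Pi.evalRingHom R k)
      invFun := fun P => Matrix.of fun i j k => P k i j
      left_inv := fun M => by ext i j k; rfl
      right_inv := fun P => by ext k i j; rfl
      map_mul' := fun M N => by
        ext k i j
        change ((M * N).map (Pi.evalRingHom R k)) i j = _
        rw [Matrix.map_mul]; rfl
      map_add' := fun M N => by ext k i j; rfl }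
  let Φ : GL ι (∀ k, R k) ≃* ∀ k, GL ι (R k) := (Units.mapEquiv φ.toMulEquiv).trans MulEquiv.piUnits
  refine closure_isSquare_eq_top_of_surjective' ?_ Φ.symm.toMonoidHom Φ.symm.surjective
  rw [eq_top_iff]
  intro x _
  refine Subgroup.pi_mem_of_mulSingle_mem x fun k => ?_
  exact map_closure_isSquare_le' (MonoidHom.mulSingle (fun k => GL ι (R k)) k)
    (Subgroup.mem_map_of_mem _ ((hR k) ▸ Subgroup.mem_top (x k)))

end Literature.LinearAlgebra.Matrix.GeneralLinearGroup
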